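import Summits.ResolutionOfSingularities.ResolutionOfSingularities.Theorems.NearCutCurvePrimes
import HarnessLib

/-!
# NearCut §P5 (decomp-res lens-3 g23, PRIME SHEDDING part 2b/3): the Krull–Akizuki monotonicity of principal lengths
# `ℓ_B(B/f(a)B) ≤ ℓ_A(A/aA)` for a birational extension `A ↪ B ⊆ A[1/t]` of one-dimensional Noetherian domains

Pure additions in namespace `Summit.ResolutionOfSingularities.ResolutionOfSingularities.Theorems.NearCut`; content =
node HOME/decomp-res-lens-3/g23/NearCut.lean §P5 verbatim (farm-checked inside the node: rc 0, 0 sorry, axioms standard).  See NODE-g23.md §2.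
[WRITER NOTE (decomp-res writer g11): the lens's tree companion `tree/NearCutCurvePrimes.lean` (fec0562d, 401 lines + 3 lint docstrings = 408)
exceeds the 400-line cap of tree files, so its last section `§P5 Monotone` (generic commutative algebra, independent of §P3–§P4) is carried
here as a separate file between `NearCutCurvePrimes` (§P3–§P4) and `NearCutPrimeShedding` (§P6–§P7); declarations verbatim.]
-/

noncomputable section

open MvPolynomial Finset
open Literature.AlgebraicGeometry.Resolution
open Literature.AlgebraicGeometry.Resolution.Hauser2010
open Literature.AlgebraicGeometry.Resolution.PointBlowup
open Summit.ResolutionOfSingularities.ResolutionOfSingularities.Theses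
open Summit.ResolutionOfSingularities.ResolutionOfSingularities.Theorems.TightDefectClasses
open Summit.ResolutionOfSingularities.ResolutionOfSingularities.Theorems.TightDefectStrongWalks
open Summit.ResolutionOfSingularities.ResolutionOfSingularities.Theorems.ItineraryCutClasses
open Summit.ResolutionOfSingularities.ResolutionOfSingularities.Theorems.BoundaryLedger
open Summit.ResolutionOfSingularities.ResolutionOfSingularities.Theorems.ProximityCut
open Summit.ResolutionOfSingularities.ResolutionOfSingularities.Theorems.ConeCutAxisLaw
open Literature.AlgebraicGeometry.Resolution.WeightedBlowup
open Literature.Barriers.ResolutionOfSingularities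
open Summit.ResolutionOfSingularities.ResolutionOfSingularities.Theorems.FloorCut
open Summit.ResolutionOfSingularities.ResolutionOfSingularities.Theorems.ConeCut
open Summit.ResolutionOfSingularities.ResolutionOfSingularities.Theorems.ExitLaw (fin3_cases eq_of_le_of_degree_le)
open Summit.ResolutionOfSingularities.ResolutionOfSingularities.Theorems.ShadeCut
open Summit.ResolutionOfSingularities.ResolutionOfSingularities.Theorems.TightCut
open Summit.ResolutionOfSingularities.ResolutionOfSingularities.Theorems.HoleCut

namespace Summit.ResolutionOfSingularities.ResolutionOfSingularities.Theorems.NearCut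

/-! ### §P5 The Krull–Akizuki monotonicity of principal lengths under a birational extension -/

section Monotone

open scoped Pointwise

/-- **Principal lengths do not increase under a birational integral-free extension.**  Let `f : A → B` be an
injective map of domains with `A` Noetherian one-dimensional, and suppose `B ⊆ f(A)[1/f(t)]` for some `t` with
`f t ≠ 0`.  Then `ℓ_B(B/f(a)B) ≤ ℓ_A(A/aA)` for every `a ≠ 0`.  Proof: restrict scalars to `A`; any finite chain of
`A`-submodules of `B/f(a)B` is witnessed inside `N/aN` for a finitely generated `A`-submodule `N ≅ J ⊴ A` (common
denominator `f(t)^e`), and `ℓ_A(J/aJ) = ℓ_A(A/aA)` by the Krull–Akizuki lemma.  [Krull–Akizuki; new packaging] [folklore] -/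
theorem length_quotient_map_le {A B : Type*} [CommRing A] [IsDomain A] [IsNoetherianRing A]
    [Ring.KrullDimLE 1 A] [CommRing B] [IsDomain B] (f : A →+* B) (hf : Function.Injective f)
    {t : A} (ht : f t ≠ 0) (hden : ∀ x : B, ∃ (e : ℕ) (a : A), f t ^ e * x = f a) {a : A} (ha : a ≠ 0) :
    Module.length B (B ⧸ Ideal.span {f a}) ≤ Module.length A (A ⧸ Ideal.span {a}) := by
  classical
  letI : Algebra A B := f.toAlgebra
  have hfa : ∀ x : A, algebraMap A B x = f x := fun _ => rfl
  set M := B ⧸ Ideal.span {f a} with hM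
  -- restriction of scalars
  have h1 : Module.length B M ≤ Module.length A M := by
    have := Submodule.length_le_length_restrictScalars A (⊤ : Submodule B M)
    rwa [Module.length_top, Submodule.restrictScalars_top, Module.length_top] at this
  refine h1.trans ?_
  rw [Module.length_eq_height A M, Order.height_le_iff]
  intro p _
  -- witnesses of the strict chain
  have hw : ∀ i : Fin p.length, ∃ x ∈ p i.succ, x ∉ p (Fin.castSucc i) :=
    fun i => SetLike.exists_of_lt (p.strictMono i.castSucc_lt_succ)
  choose x hxmem hxnot using hw
  choose β hβ using fun i => Ideal.Quotient.mk_surjective (I := Ideal.span {f a}) (x i)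
  choose e g hg using fun i => hden (β i)
  -- common denominator
  set E := ∑ i, e i with hE
  have heE : ∀ i, e i ≤ E := fun i => Finset.single_le_sum (fun k _ => Nat.zero_le (e k)) (Finset.mem_univ i)
  have hgE : ∀ i, f t ^ E * β i = f (t ^ (E - e i) * g i) := fun i => by
    rw [map_mul, map_pow, ← hg i, ← mul_assoc, ← pow_add, Nat.sub_add_cancel (heE i)]
  -- the A-linear maps `D = (f t)^E ·` and `F = f`
  set D : B →ₗ[A] B := LinearMap.mulLeft A (f t ^ E) with hD
  set F : A →ₗ[A] B := Algebra.linearMap A B with hF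
  have hDapp : ∀ y, D y = f t ^ E * y := fun y => LinearMap.mulLeft_apply _ _ _
  have hFapp : ∀ y, F y = f y := fun y => rfl
  have hDinj : Function.Injective D := fun y₁ y₂ h => by
    rw [hDapp, hDapp] at h
    exact mul_left_cancel₀ (pow_ne_zero E ht) h
  have hFinj : Function.Injective F := hf
  set N : Submodule A B := Submodule.comap D (LinearMap.range F) with hN
  set J : Ideal A := Submodule.comap F (LinearMap.range D) with hJ
  have hβN : ∀ i, β i ∈ N := fun i => by
    rw [hN, Submodule.mem_comap, hDapp, hgE, LinearMap.mem_range]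
    exact ⟨_, rfl⟩
  have htE : t ^ E ≠ 0 := pow_ne_zero E fun h => ht (by rw [h, map_zero])
  have hJne : J ≠ ⊥ := by
    intro h
    apply htE
    have : t ^ E ∈ J := by
      rw [hJ, Submodule.mem_comap, LinearMap.mem_range]
      exact ⟨1, by rw [hDapp, mul_one, hFapp, map_pow]⟩
    rwa [h, Submodule.mem_bot] at this
  -- `N ≃ J`
  have e₁ : N ≃ₗ[A] J := by
    refine (Submodule.equivMapOfInjective D hDinj N).trans
      ((LinearEquiv.ofEq _ _ ?_).trans (Submodule.equivMapOfInjective F hFinj J).symm)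
    rw [hN, hJ, Submodule.map_comap_eq, Submodule.map_comap_eq, inf_comm]
  have e₂ : QuotSMulTop a N ≃ₗ[A] QuotSMulTop a J :=
    Submodule.Quotient.equiv (a • ⊤) (a • ⊤) e₁
      (by rw [Submodule.map_pointwise_smul, Submodule.map_top, LinearEquiv.range])
  have hlen : Module.length A (QuotSMulTop a N) = Module.length A (A ⧸ Ideal.span {a}) := by
    rw [e₂.length_eq, length_quotSMulTop_ideal_eq hJne ha]
  -- the map `N/aN → M`
  set ρ : N →ₗ[A] M := ((Submodule.mkQ (Ideal.span {f a})).restrictScalars A).comp N.subtype with hρ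
  have hρapp : ∀ n : N, ρ n = Ideal.Quotient.mk (Ideal.span {f a}) (n : B) := fun n => rfl
  have hρker : (a • ⊤ : Submodule A N) ≤ LinearMap.ker ρ := by
    intro n hn
    obtain ⟨m, -, rfl⟩ := (Submodule.mem_smul_pointwise_iff_exists _ _ _).mp hn
    rw [LinearMap.mem_ker, hρapp, Submodule.coe_smul, Algebra.smul_def, hfa, Ideal.Quotient.eq_zero_iff_mem]
    exact Ideal.mul_mem_right _ _ (Ideal.mem_span_singleton_self _)
  set ρ' : QuotSMulTop a N →ₗ[A] M := (a • ⊤ : Submodule A N).liftQ ρ hρker with hρ'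
  have hρ'β : ∀ i, ρ' (Submodule.Quotient.mk ⟨β i, hβN i⟩) = x i := fun i => by
    rw [hρ', Submodule.liftQ_apply, hρapp]
    exact hβ i
  -- pull the chain back
  have hmono : StrictMono fun k : Fin (p.length + 1) => (p k).comap ρ' := by
    refine Fin.strictMono_iff_lt_succ.mpr fun i => lt_of_le_of_ne ?_ ?_
    · exact Submodule.comap_mono (p.strictMono i.castSucc_lt_succ).le
    · intro h
      apply hxnot i
      have : Submodule.Quotient.mk (p := (a • ⊤ : Submodule A N)) ⟨β i, hβN i⟩ ∈ (p i.succ).comap ρ' := by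
        rw [Submodule.mem_comap, hρ'β]
        exact hxmem i
      rw [← h, Submodule.mem_comap, hρ'β] at this
      exact this
  have hq := Order.length_le_height (p := LTSeries.mk p.length _ hmono) (x := ⊤) le_top
  simp only [LTSeries.mk_length] at hq
  rw [← Module.length_eq_height, hlen] at hq
  exact hq

end Monotone

end Summit.ResolutionOfSingularities.ResolutionOfSingularities.Theorems.NearCut
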